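import Summits.QuantumFields.BalabanUV.Beta.FP.PerfectRemainderSliceLocalLetters
import Summits.QuantumFields.BalabanUV.Beta.FP.PuncturedCoordDerivMajorant
import Summits.QuantumFields.BalabanUV.Beta.FP.PerfectPropagatorSplit
import Summits.QuantumFields.BalabanUV.Beta.FP.BrillouinRadial
import Summits.QuantumFields.BalabanUV.Beta.GAN24.DirichletExhaustionDeltaZSymm

/-!
# `BalabanUV.Beta.FP.PerfectPropagatorKernel` — road «FP» for binder row D1, leaf H2-P, row **H2-P-KER-ASM v1** (owner re-assignment CLAIMS l.21097, R-FP-21 (B3),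
# INTENT l.21819, GO l.21970): THE x-SPACE KERNEL OF THE UNCONSTRAINED PERFECT PROPAGATOR — (K0) definition, extension-independence and the split
# `PinfKer = [α=β]·freeKer + KB` (`Re freeKer = latticeGreen∕2`); (K1) `‖KB α β z‖ ≤ CKB d∕‖z‖_∞³` (`z ≠ 0`, lattice dimension `d+1 ≥ 4`); the global bound `‖KB‖ ≤ CB0 d`

HONEST DEPENDENCY (page 1, mandatory): continuum YM on T⁴ ⇐ BetaPertH ∧ nine spine estimates (0/9 proved); BetaPertH ⇐ (D1) ∧ (D4) ∧ CAP+tail;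
G-an2-4 gates asym, D1 and NE2/3/4.  HONEST FRAMING (cell contract, verbatim): «discharging `BetaPertH` makes Bałaban's UV stability UNCONDITIONAL —
a real constructive-QFT result; it is NOT the continuum limit and NOT the Clay problem.»  THIS MODULE DISCHARGES NOTHING of the wall: it assembles, BY NAME, the
order-3 slice chain of the remainder symbol at `Re W_∞` (`FP/PerfectRemainderSliceLocal(Letters)`, p238395 ∕ p238536), the majorised IBP tool
(`FP/PuncturedCoordDerivMajorant`, p238350), the radial integrability `(‖s‖³)⁻¹ ∈ L¹(BZ (d+1))` for `3 ≤ d` (`FP/BrillouinRadial`, gan24-leaf-03-g42), the split and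
boundedness of `B` (`FP/PerfectPropagatorSplit`, gan24-p3-g16) and the integrability of the `PinfSym` integrand (`FP/PerfectPropagatorBound`).  Data defs = NAMES
(`reVec`, `symP`, `symFree`, `symB`, `PinfKer`, `freeKer`, `KB`, `chainB`) and two explicit real constants (`CB0`, `CKB`) [our object]; no `def … : Prop`; nothing cited;
0 sorry; 0 wall binders; NOT D1, NOT BetaPertH, NOT continuum, NOT Clay.  «not in print; our bookkeeping over the road's own `k = ∞` objects».

ABSOLUTE RULE (cell charter, verbatim): «No internally-minted statement may enter as a cited fact. Every hypothesis is either kernel-proved in this package or a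
verbatim quotation of a PUBLISHED theorem with page reference. The manuscript(s) under audit are NOT citable for their own disputed steps — they are the thing
under adjudication; programme-internal (2001/route/tribunal) claims are never citable.»

WHAT (lattice dimension `d + 1`, sup norm `‖z‖_∞ = B4ContourShift.supNorm z`):
* §1 (K0) [our object] `reVec p := (Re p_a)_a`; the symbols read through real parts — ONE admissible complex extension each — `symP α β p := PinfSym (reVec p) (p̂ (reVec p)) α β`,
  `symFree p := (2ε(reVec p))⁻¹`, **`symB α β := symP α β − [α = β]·symFree`** (the remainder symbol `B` of H2-P-SPLIT-B); the kernels `PinfKer α β z := latticeKernel (symP α β) z`,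
  `freeKer z := latticeKernel symFree z`, **`KB α β z := latticeKernel (symB α β) z`**; EXTENSION-INDEPENDENCE (the tree's `GAN24.DirichletExhaustionDeltaZSymm.latticeKernel_congr_BZ`:
  any two symbols agreeing on the real zone have the same kernel) `latticeKernel_eq_PinfKer`, `latticeKernel_eq_KB`; integrability of the three box integrands (`3 ≤ d+1` for `symP`∕`symFree`; `symB` for
  every `d`, being bounded and continuous on the punctured zone); **THE SPLIT `PinfKer_eq_free_add_KB : PinfKer α β z = [α=β]·freeKer z + KB α β z`** (`3 ≤ d+1`) with
  **`re_freeKer : Re (freeKer z) = latticeGreen z ∕ 2`** (`PerfectPropagatorSplit.re_latticeKernel_free`) and `re_PinfKer`.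
* §2 [our object] the GLOBAL bound: `norm_symB_le` (`‖B(s)‖ ≤ CB0 d := 2(d+1)²·CW (d+1)·(π²∕4)^{d+3}` off the origin, `norm_PinfSym_d1Sym_sub_free_le'`), whence
  **`norm_KB_le : ‖KB α β z‖ ≤ CB0 d`** for every `z` (`vol(BZ) = (2π)^{d+1}`).
* §3 [our object] the punctured slice chain `chainB α β μ j` of `symB` in the coordinate `μ` (members 1–3 = `remSl1∕2∕3` of p235721 read through real parts) and its
  rows for `PuncturedCoordDerivMajorant`: `chainB_succ_slice`, `symB_slice_eq`, links ∕ continuity ∕ endpoint values ∕ measurability ∕ majorant `27·Krem d∕‖s‖³`.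
* §4 **(K1) `norm_KB_le_div_supNorm_cube (hd : 3 ≤ d) (hz : z ≠ 0) : ‖KB α β z‖ ≤ CKB d ∕ ‖z‖_∞³`**, `CKB d := (2π)^{−(d+1)}·∫_{BZ (d+1)} 27·Krem d·(‖s‖³)⁻¹ ds` — three
  integrations by parts in the coordinate realising `‖z‖_∞`.
The graded corollaries (K2′)∕(K3′), the `(‖z‖_∞+1)⁻²∕⁻³` consumer letters of IR-1-ABS for `P := Re PinfKer` and (K4) are the sequels `FP/PerfectPropagatorKernelLegs` ∕
`…Symm`.  Exponents 4∕5 ((K2)∕(K3)) = v1.1 on the order-5 chain (CHAIN-N ∕ REG-N).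
Provenance: G-an2-4 swarm leaf prover 05, gen 35 (prover-b2b-balaban-gan24-formalise-leaf-05-g35-0), cross-lane on road FP, 2026-08-20.
-/

noncomputable section

namespace Summit.QuantumFields.BalabanUV.Beta.FP.PerfectPropagatorKernel

open MeasureTheory Set Complex Filter Topology Finset
open scoped Real BigOperators
open Literature.MathematicalPhysics.QuantumFieldTheory.Balaban1983to89
open B4Strip (ofRealVec)
open B4ContourShift (BZ phase integrand fourierBox latticeKernel supNorm ofRealVec_insertNth norm_cexp_phase)
open B5Prop11Fiber (d1Sym)
open Literature.Probability.LatticeModels (dispersion latticeGreen continuous_dispersion)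
open Summit.QuantumFields.BalabanUV.Beta.FP.PerfectSymbol166Flat (CW CW_nonneg)
open Summit.QuantumFields.BalabanUV.Beta.FP.PerfectPropagatorSymbol (PinfSym)
open Summit.QuantumFields.BalabanUV.Beta.FP.PerfectPropagatorBound (d1Sym_ne_zero sum_norm_d1Sym_sq sum_norm_sq_pos continuousOn_PinfSym_d1Sym_apply
  integrableOn_integrand_of_eq_PinfSym)
open Summit.QuantumFields.BalabanUV.Beta.FP.PerfectPropagatorSplit (integrableOn_integrand_free re_latticeKernel_free norm_PinfSym_d1Sym_sub_free_le')
open Summit.QuantumFields.BalabanUV.Beta.FP.PuncturedCoordDeriv (integrableOn_integrand_of_norm_le_mul_norm_rpow_neg norm_fourierBox_le_integral_norm)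
open Summit.QuantumFields.BalabanUV.Beta.FP.PuncturedCoordDerivMajorant (norm_latticeKernel_le_div_supNorm_pow_of_majorant)
open Summit.QuantumFields.BalabanUV.Beta.FP.BrillouinRadial (integrableOn_inv_norm_pow_BZ)
open Summit.QuantumFields.BalabanUV.Beta.FP.RemainderSymbolSlice (remSl0 remSl1 remSl2 remSl3)
open Summit.QuantumFields.BalabanUV.Beta.FP.PerfectPropagatorRemainderSymbol (wInf remSl0_wInf_eq)
open Summit.QuantumFields.BalabanUV.Beta.FP.MaxwellSymbolDeriv (update_insertNth)
open Summit.QuantumFields.BalabanUV.Beta.FP.PerfectSymbolDeriv (norm_le_pi_of_mem_BZ)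
open Summit.QuantumFields.BalabanUV.Beta.FP.PerfectRemainderSliceLocal
open Summit.QuantumFields.BalabanUV.Beta.GAN24.DirichletExhaustionDeltaZSymm (latticeKernel_congr_BZ)

variable {d : ℕ}

/-! ## §1 (K0) The symbols read through real parts, the kernels, extension-independence, the split -/

/-- [our object] the real parts of a complex momentum vector. -/
def reVec (p : Fin (d + 1) → ℂ) : Fin (d + 1) → ℝ := fun a => (p a).re

/-- [folklore] `reVec (ofRealVec s) = s`. -/
@[simp] theorem reVec_ofRealVec (s : Fin (d + 1) → ℝ) : reVec (ofRealVec s) = s := by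
  funext a; simp [reVec, ofRealVec]

/-- [folklore] `reVec (insertNth i t (ofRealVec q)) = insertNth i t q`. -/
theorem reVec_insertNth (i : Fin (d + 1)) (t : ℝ) (q : Fin d → ℝ) : reVec (i.insertNth (t : ℂ) (ofRealVec q)) = i.insertNth t q := by
  rw [← ofRealVec_insertNth, reVec_ofRealVec]

/-- [our object] THE PERFECT PROPAGATOR ENTRY SYMBOL read through real parts: `symP α β p := PinfSym (reVec p) (p̂ (reVec p)) α β`. -/
def symP (α β : Fin (d + 1)) (p : Fin (d + 1) → ℂ) : ℂ := PinfSym (reVec p) (d1Sym (reVec p)) α β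

/-- [our object] THE FREE SYMBOL read through real parts: `symFree p := (2ε(reVec p))⁻¹ = ‖p̂‖⁻²`. -/
def symFree (p : Fin (d + 1) → ℂ) : ℂ := ((((2 * dispersion (reVec p))⁻¹ : ℝ)) : ℂ)

/-- [our object] **THE REMAINDER SYMBOL `B` read through real parts**: `symB α β := symP α β − [α = β]·symFree`. -/
def symB (α β : Fin (d + 1)) (p : Fin (d + 1) → ℂ) : ℂ := symP α β p - (if α = β then symFree p else 0)

/-- [our object] THE KERNEL OF THE UNCONSTRAINED PERFECT PROPAGATOR (entry `αβ`): `PinfKer α β z := latticeKernel (symP α β) z`. -/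
def PinfKer (α β : Fin (d + 1)) (z : Fin (d + 1) → ℤ) : ℂ := latticeKernel (symP α β) z

/-- [our object] THE FREE KERNEL `freeKer z := latticeKernel symFree z` (`Re = latticeGreen∕2`, §1 below). -/
def freeKer (z : Fin (d + 1) → ℤ) : ℂ := latticeKernel (symFree (d := d)) z

/-- [our object] **THE REMAINDER KERNEL `KB α β z := latticeKernel (symB α β) z`.** -/
def KB (α β : Fin (d + 1)) (z : Fin (d + 1) → ℤ) : ℂ := latticeKernel (symB α β) z

/-- [folklore] evaluation on the real zone: `symP α β (ofRealVec s) = PinfSym s (p̂ s) α β`. -/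
@[simp] theorem symP_ofRealVec (α β : Fin (d + 1)) (s : Fin (d + 1) → ℝ) : symP α β (ofRealVec s) = PinfSym s (d1Sym s) α β := by
  simp [symP]

/-- [folklore] `symFree (ofRealVec s) = (2ε(s))⁻¹`. -/
@[simp] theorem symFree_ofRealVec (s : Fin (d + 1) → ℝ) : symFree (ofRealVec s) = ((((2 * dispersion s)⁻¹ : ℝ)) : ℂ) := by
  simp [symFree]

/-- [folklore] `symB (ofRealVec s) = PinfSym s (p̂ s) α β − [α=β]∕(2ε(s))`. -/
theorem symB_ofRealVec (α β : Fin (d + 1)) (s : Fin (d + 1) → ℝ) :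
    symB α β (ofRealVec s) = PinfSym s (d1Sym s) α β - (if α = β then ((((2 * dispersion s)⁻¹ : ℝ)) : ℂ) else 0) := by
  simp [symB]

/- EXTENSION-INDEPENDENCE (two symbols agreeing at the real momenta of the zone have the same lattice kernel) is the tree's
`GAN24.DirichletExhaustionDeltaZSymm.latticeKernel_congr_BZ` (gan24-p2), reused BY NAME below. -/

/-- [our object] any symbol agreeing with the `PinfSym` entry on the real zone has kernel `PinfKer`. -/
theorem latticeKernel_eq_PinfKer {G : (Fin (d + 1) → ℂ) → ℂ} {α β : Fin (d + 1)} (hG : ∀ s ∈ BZ (d + 1), G (ofRealVec s) = PinfSym s (d1Sym s) α β)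
    (z : Fin (d + 1) → ℤ) : latticeKernel G z = PinfKer α β z :=
  latticeKernel_congr_BZ (fun s hs => by rw [hG s hs, symP_ofRealVec]) z

/-- [our object] any symbol agreeing with `B` on the real zone has kernel `KB`. -/
theorem latticeKernel_eq_KB {G : (Fin (d + 1) → ℂ) → ℂ} {α β : Fin (d + 1)}
    (hG : ∀ s ∈ BZ (d + 1), G (ofRealVec s) = PinfSym s (d1Sym s) α β - (if α = β then ((((2 * dispersion s)⁻¹ : ℝ)) : ℂ) else 0))
    (z : Fin (d + 1) → ℤ) : latticeKernel G z = KB α β z :=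
  latticeKernel_congr_BZ (fun s hs => by rw [hG s hs, symB_ofRealVec]) z

/-- [folklore] the box integrand is additive ∕ subtractive in the symbol. -/
theorem integrand_sub (G G' : (Fin (d + 1) → ℂ) → ℂ) (x : Fin (d + 1) → ℤ) :
    integrand (fun p => G p - G' p) x = fun s => integrand G x s - integrand G' x s := by
  funext s; unfold integrand; ring

/-- [our object] the `symP` integrand is integrable on the zone (`3 ≤ d+1`; `FP/PerfectPropagatorBound`). -/
theorem integrableOn_integrand_symP (hd : 3 ≤ d + 1) (α β : Fin (d + 1)) (x : Fin (d + 1) → ℤ) :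
    IntegrableOn (integrand (symP α β) x) (BZ (d + 1)) volume :=
  integrableOn_integrand_of_eq_PinfSym hd (fun s _ => symP_ofRealVec α β s) x

/-- [our object] the free integrand is integrable on the zone (`3 ≤ d+1`; `FP/PerfectPropagatorSplit`). -/
theorem integrableOn_integrand_symFree (hd : 3 ≤ d + 1) (x : Fin (d + 1) → ℤ) :
    IntegrableOn (integrand (symFree (d := d)) x) (BZ (d + 1)) volume :=
  integrableOn_integrand_free hd (fun s _ => symFree_ofRealVec s) x

/-! ## §2 The global bound -/

/-- [our object] `CB0 d := 2(d+1)²·CW (d+1)·(π²∕4)^{d+3}` — the sup of `‖B‖` on the punctured zone (`norm_PinfSym_d1Sym_sub_free_le'`). -/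
def CB0 (d : ℕ) : ℝ := 2 * ((d : ℝ) + 1) ^ 2 * CW (d + 1) * (Real.pi ^ 2 / 4) ^ (d + 1 + 2)

/-- [folklore] `0 ≤ CB0 d`. -/
theorem CB0_nonneg (d : ℕ) : 0 ≤ CB0 d := by
  unfold CB0; have := CW_nonneg (d + 1); positivity

/-- [our object] **`‖B(s)‖ ≤ CB0 d` OFF THE ORIGIN OF THE ZONE.** -/
theorem norm_symB_le (α β : Fin (d + 1)) {s : Fin (d + 1) → ℝ} (hs : s ∈ BZ (d + 1)) (h0 : s ≠ 0) : ‖symB α β (ofRealVec s)‖ ≤ CB0 d := by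
  rw [symB_ofRealVec]
  refine (norm_PinfSym_d1Sym_sub_free_le' hs h0 α β).trans (le_of_eq ?_)
  unfold CB0; push_cast; ring

/-- [folklore] `B` is continuous on the punctured zone. -/
theorem continuousOn_symB (α β : Fin (d + 1)) : ContinuousOn (fun s : Fin (d + 1) → ℝ => symB α β (ofRealVec s)) (BZ (d + 1) \ {0}) := by
  have h1 : ContinuousOn (fun s : Fin (d + 1) → ℝ => PinfSym s (d1Sym s) α β) (BZ (d + 1) \ {0}) := continuousOn_PinfSym_d1Sym_apply α β
  have h2 : ContinuousOn (fun s : Fin (d + 1) → ℝ => ((((2 * dispersion s)⁻¹ : ℝ)) : ℂ)) (BZ (d + 1) \ {0}) := by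
    refine Complex.continuous_ofReal.comp_continuousOn ((continuous_const.mul (continuous_dispersion (d + 1))).continuousOn.inv₀ fun s hs => ?_)
    have hpos : 0 < ∑ a, ‖d1Sym s a‖ ^ 2 := sum_norm_sq_pos (d1Sym_ne_zero hs.1 hs.2)
    rw [sum_norm_d1Sym_sq] at hpos
    exact hpos.ne'
  by_cases hab : α = β
  · refine (h1.sub h2).congr fun s _ => ?_
    simp [symB_ofRealVec, hab]
  · refine h1.congr fun s _ => ?_
    simp [symB_ofRealVec, hab]

/-- [our object] the `symB` integrand is integrable on the zone for every `d` (bounded, continuous on the punctured zone). -/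
theorem integrableOn_integrand_symB (α β : Fin (d + 1)) (x : Fin (d + 1) → ℤ) : IntegrableOn (integrand (symB α β) x) (BZ (d + 1)) volume :=
  integrableOn_integrand_of_norm_le_mul_norm_rpow_neg (CB0_nonneg d) (by exact_mod_cast Nat.succ_pos d : (0 : ℝ) < d + 1) (continuousOn_symB α β)
    (fun s hs h0 => by rw [neg_zero, Real.rpow_zero, mul_one]; exact norm_symB_le α β hs h0) x

/-- [folklore] the volume of the zone: `vol(BZ (d+1)) = (2π)^{d+1}`. -/
theorem volume_real_BZ : volume.real (BZ (d + 1)) = (2 * π) ^ (d + 1) := by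
  unfold BZ
  rw [measureReal_def, Real.volume_Icc_pi_toReal (fun _ => by linarith [Real.pi_pos])]
  simp only [sub_neg_eq_add, Finset.prod_const, Finset.card_univ, Fintype.card_fin]
  ring

/-- [our object] **THE GLOBAL BOUND `‖KB α β z‖ ≤ CB0 d`** for every `z` (`‖e^{is·z}‖ = 1`, `vol(BZ) = (2π)^{d+1}`). -/
theorem norm_KB_le (α β : Fin (d + 1)) (z : Fin (d + 1) → ℤ) : ‖KB α β z‖ ≤ CB0 d := by
  have hpos : (0 : ℝ) < (2 * π) ^ (d + 1) := by positivity
  have hvol : volume (BZ (d + 1)) < ⊤ := by unfold BZ; exact measure_Icc_lt_top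
  have hae : ∀ᵐ s ∂(volume.restrict (BZ (d + 1))), ‖integrand (symB α β) z s‖ ≤ CB0 d := by
    have h0 : ∀ᵐ s ∂(volume : Measure (Fin (d + 1) → ℝ)), s ∉ ({0} : Set (Fin (d + 1) → ℝ)) :=
      measure_eq_zero_iff_ae_notMem.mp (measure_singleton 0)
    filter_upwards [ae_restrict_mem (by unfold BZ; exact measurableSet_Icc), ae_restrict_of_ae h0] with s hs hs0
    unfold integrand
    rw [norm_mul, norm_cexp_phase, mul_one]
    exact norm_symB_le α β hs hs0
  have hint := norm_setIntegral_le_of_norm_le_const_ae hvol hae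
  rw [volume_real_BZ] at hint
  unfold KB latticeKernel fourierBox
  rw [norm_smul, Real.norm_eq_abs, abs_of_pos (inv_pos.mpr hpos)]
  calc ((2 * π) ^ (d + 1))⁻¹ * ‖∫ s in BZ (d + 1), integrand (symB α β) z s‖
      ≤ ((2 * π) ^ (d + 1))⁻¹ * (CB0 d * (2 * π) ^ (d + 1)) := mul_le_mul_of_nonneg_left hint (inv_pos.mpr hpos).le
    _ = CB0 d := by field_simp

/-! ## §1 (continued) The split and the real part of the free kernel -/

/-- [our object] **THE SPLIT**: `PinfKer α β z = [α = β]·freeKer z + KB α β z` (`3 ≤ d+1`). -/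
theorem PinfKer_eq_free_add_KB (hd : 3 ≤ d + 1) (α β : Fin (d + 1)) (z : Fin (d + 1) → ℤ) :
    PinfKer α β z = (if α = β then freeKer z else 0) + KB α β z := by
  by_cases hab : α = β
  · rw [if_pos hab]
    have hsub : KB α β z = PinfKer α β z - freeKer z := by
      unfold KB PinfKer freeKer latticeKernel fourierBox
      have e : integrand (symB α β) z = fun s => integrand (symP α β) z s - integrand (symFree (d := d)) z s := by
        rw [← integrand_sub]; congr 1; funext p; simp [symB, hab]
      rw [e, integral_sub (integrableOn_integrand_symP hd α β z) (integrableOn_integrand_symFree hd z), smul_sub]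
    rw [hsub]; ring
  · rw [if_neg hab, zero_add]
    unfold KB PinfKer
    congr 1; funext p; simp [symB, hab]

/-- [our object] **`Re freeKer z = latticeGreen z ∕ 2`** (`3 ≤ d+1`; `PerfectPropagatorSplit.re_latticeKernel_free` — an3's free table leg `gFree`). -/
theorem re_freeKer (hd : 3 ≤ d + 1) (z : Fin (d + 1) → ℤ) : (freeKer (d := d) z).re = latticeGreen z / 2 :=
  re_latticeKernel_free hd (fun s _ => symFree_ofRealVec s) z

/-- [our object] the real part of the propagator kernel: `Re PinfKer α β z = [α = β]·latticeGreen z∕2 + Re KB α β z`. -/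
theorem re_PinfKer (hd : 3 ≤ d + 1) (α β : Fin (d + 1)) (z : Fin (d + 1) → ℤ) :
    (PinfKer α β z).re = (if α = β then latticeGreen z / 2 else 0) + (KB α β z).re := by
  rw [PinfKer_eq_free_add_KB hd, Complex.add_re]
  by_cases hab : α = β
  · rw [if_pos hab, if_pos hab, re_freeKer hd]
  · rw [if_neg hab, if_neg hab, Complex.zero_re]

/-! ## §3 The punctured slice chain of `symB` and its rows -/

/-- [our object] THE PUNCTURED SLICE CHAIN OF `symB` IN THE COORDINATE `μ`: member `0` is `symB`, members `1, 2, 3` (and beyond, frozen) are `remSl1∕2∕3` at `Re W_∞`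
read through real parts (base point `reVec p`, parameter `Re p_μ`). -/
def chainB (α β μ : Fin (d + 1)) : ℕ → (Fin (d + 1) → ℂ) → ℂ
  | 0 => symB α β
  | 1 => fun p => remSl1 (wInf (d := d)) (reVec p) μ α β ((p μ).re)
  | 2 => fun p => remSl2 (wInf (d := d)) (reVec p) μ α β ((p μ).re)
  | _ + 3 => fun p => remSl3 (wInf (d := d)) (reVec p) μ α β ((p μ).re)

section Rows

variable (α β μ : Fin (d + 1)) {q : Fin d → ℝ}

/-- [folklore] the transverse part of the base point `insertNth μ 0 q` is `q`. -/
theorem removeNth_base (q : Fin d → ℝ) : μ.removeNth (μ.insertNth (0 : ℝ) q : Fin (d + 1) → ℝ) = q := by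
  simp

/-- [our object] THE MEMBERS ON A SLICE, at the fixed base point `insertNth μ 0 q`:
`chainB 1∕2∕3 (insertNth μ t q) = remSl1∕2∕3 wInf (insertNth μ 0 q) μ α β t`. -/
theorem chainB_succ_slice (q : Fin d → ℝ) (t : ℝ) :
    chainB α β μ 1 (μ.insertNth (t : ℂ) (ofRealVec q)) = remSl1 (wInf (d := d)) (μ.insertNth (0 : ℝ) q) μ α β t ∧
      chainB α β μ 2 (μ.insertNth (t : ℂ) (ofRealVec q)) = remSl2 (wInf (d := d)) (μ.insertNth (0 : ℝ) q) μ α β t ∧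
      chainB α β μ 3 (μ.insertNth (t : ℂ) (ofRealVec q)) = remSl3 (wInf (d := d)) (μ.insertNth (0 : ℝ) q) μ α β t := by
  have e1 : reVec (μ.insertNth (t : ℂ) (ofRealVec q)) = Function.update (μ.insertNth (0 : ℝ) q) μ t := by
    rw [reVec_insertNth, update_insertNth]
  have e2 : ((μ.insertNth (t : ℂ) (ofRealVec q) : Fin (d + 1) → ℂ) μ).re = t := by simp
  refine ⟨?_, ?_, ?_⟩
  · simp only [chainB, e1, e2, remSl1_update]
  · simp only [chainB, e1, e2, remSl2_update]
  · simp only [chainB, e1, e2, remSl3_update]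

variable {α β μ}

/-- [our object] **ON A PUNCTURED SLICE `symB` IS `remSl0`**: for `t ∈ [−π,π]`, `q ∈ BZ d ∖ {0}`,
`symB α β (insertNth μ t q) = remSl0 wInf (insertNth μ 0 q) μ α β t` (`remSl0_wInf_eq` + `‖p̂‖² = 2ε`). -/
theorem symB_slice_eq (hq : q ∈ BZ d) (hq0 : q ≠ 0) {t : ℝ} (ht : t ∈ Icc (-π) π) :
    symB α β (μ.insertNth (t : ℂ) (ofRealVec q)) = remSl0 (wInf (d := d)) (μ.insertNth (0 : ℝ) q) μ α β t := by
  have hq' : μ.removeNth (μ.insertNth (0 : ℝ) q : Fin (d + 1) → ℝ) ∈ BZ d := by rwa [removeNth_base]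
  have hq0' : μ.removeNth (μ.insertNth (0 : ℝ) q : Fin (d + 1) → ℝ) ≠ 0 := by rwa [removeNth_base]
  rw [remSl0_wInf_eq ht hq' hq0' α β, update_insertNth, ← ofRealVec_insertNth, symB_ofRealVec, sum_norm_d1Sym_sq]

/-- [our object] the `hder` rows: links of the chain on the open interval (member 0 by `symB_slice_eq` near `t`, then `hasDerivAt_remSl0∕1∕2_wInf_U`). -/
theorem chainB_hder (hq : q ∈ BZ d) (hq0 : q ≠ 0) :
    ∀ j < 3, ∀ t ∈ Ioo (-π) π, HasDerivAt (fun s : ℝ => chainB α β μ j (μ.insertNth (s : ℂ) (ofRealVec q)))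
      (chainB α β μ (j + 1) (μ.insertNth (t : ℂ) (ofRealVec q))) t := by
  have hq' : μ.removeNth (μ.insertNth (0 : ℝ) q : Fin (d + 1) → ℝ) ∈ BZ d := by rwa [removeNth_base]
  have hq0' : μ.removeNth (μ.insertNth (0 : ℝ) q : Fin (d + 1) → ℝ) ≠ 0 := by rwa [removeNth_base]
  intro j hj t ht
  have htU := Icc_subset_U (d := d) (Ioo_subset_Icc_self ht)
  obtain ⟨c1, c2, c3⟩ := chainB_succ_slice α β μ q t
  interval_cases j
  · -- member 0: `symB` agrees with `remSl0` on the open interval around `t`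
    rw [show (0 + 1 : ℕ) = 1 from rfl, c1]
    have hev : (fun s : ℝ => chainB α β μ 0 (μ.insertNth (s : ℂ) (ofRealVec q))) =ᶠ[𝓝 t] remSl0 (wInf (d := d)) (μ.insertNth (0 : ℝ) q) μ α β :=
      Filter.eventuallyEq_of_mem (isOpen_Ioo.mem_nhds ht) fun s hs => symB_slice_eq hq hq0 (Ioo_subset_Icc_self hs)
    exact (hasDerivAt_remSl0_wInf_U hq' hq0' htU α β).congr_of_eventuallyEq hev
  · rw [show (1 + 1 : ℕ) = 2 from rfl, c2]
    have e : (fun s : ℝ => chainB α β μ 1 (μ.insertNth (s : ℂ) (ofRealVec q))) = remSl1 (wInf (d := d)) (μ.insertNth (0 : ℝ) q) μ α β := by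
      funext s; exact (chainB_succ_slice α β μ q s).1
    rw [e]; exact hasDerivAt_remSl1_wInf_U hq' hq0' htU α β
  · rw [show (2 + 1 : ℕ) = 3 from rfl, c3]
    have e : (fun s : ℝ => chainB α β μ 2 (μ.insertNth (s : ℂ) (ofRealVec q))) = remSl2 (wInf (d := d)) (μ.insertNth (0 : ℝ) q) μ α β := by
      funext s; exact (chainB_succ_slice α β μ q s).2.1
    rw [e]; exact hasDerivAt_remSl2_wInf_U hq' hq0' htU α β

/-- [our object] the `hcont` rows: members `0, 1, 2` are continuous on `[−π, π]`. -/
theorem chainB_hcont (hq : q ∈ BZ d) (hq0 : q ≠ 0) :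
    ∀ j < 3, ContinuousOn (fun s : ℝ => chainB α β μ j (μ.insertNth (s : ℂ) (ofRealVec q))) (uIcc (-π) π) := by
  have hq' : μ.removeNth (μ.insertNth (0 : ℝ) q : Fin (d + 1) → ℝ) ∈ BZ d := by rwa [removeNth_base]
  have hq0' : μ.removeNth (μ.insertNth (0 : ℝ) q : Fin (d + 1) → ℝ) ≠ 0 := by rwa [removeNth_base]
  have hππ : -π ≤ π := by linarith [Real.pi_pos]
  obtain ⟨h0, h1, h2⟩ := continuousOn_remSl_wInf_U hq' hq0' α β
  intro j hj
  rw [uIcc_of_le hππ]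
  interval_cases j
  · exact (h0.mono Icc_subset_U).congr fun s hs => symB_slice_eq hq hq0 hs
  · exact (h1.mono Icc_subset_U).congr fun s _ => (chainB_succ_slice α β μ q s).1
  · exact (h2.mono Icc_subset_U).congr fun s _ => (chainB_succ_slice α β μ q s).2.1

/-- [our object] the `hper` rows: members `0, 1, 2` take equal values at `∓π` (`remSl_wInf_endpoints`). -/
theorem chainB_hper (hq : q ∈ BZ d) (hq0 : q ≠ 0) :
    ∀ j < 3, chainB α β μ j (μ.insertNth (((-π : ℝ)) : ℂ) (ofRealVec q)) = chainB α β μ j (μ.insertNth ((π : ℝ) : ℂ) (ofRealVec q)) := by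
  have hq' : μ.removeNth (μ.insertNth (0 : ℝ) q : Fin (d + 1) → ℝ) ∈ BZ d := by rwa [removeNth_base]
  have hq0' : μ.removeNth (μ.insertNth (0 : ℝ) q : Fin (d + 1) → ℝ) ≠ 0 := by rwa [removeNth_base]
  have hππ : -π ≤ π := by linarith [Real.pi_pos]
  obtain ⟨e0, e1, e2, -⟩ := remSl_wInf_endpoints hq' hq0' α β
  intro j hj
  interval_cases j
  · show symB α β _ = symB α β _
    rw [symB_slice_eq hq hq0 ⟨le_rfl, hππ⟩, symB_slice_eq hq hq0 ⟨hππ, le_rfl⟩, e0]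
  · rw [(chainB_succ_slice α β μ q (-π)).1, (chainB_succ_slice α β μ q π).1, e1]
  · rw [(chainB_succ_slice α β μ q (-π)).2.1, (chainB_succ_slice α β μ q π).2.1, e2]

/-- [our object] the `hmeas` row: the top slice is a.e.-strongly measurable on `[−π,π]`. -/
theorem chainB_hmeas (hq : q ∈ BZ d) (hq0 : q ≠ 0) :
    AEStronglyMeasurable (fun s : ℝ => chainB α β μ 3 (μ.insertNth (s : ℂ) (ofRealVec q))) (volume.restrict (Icc (-π) π)) := by
  have hq' : μ.removeNth (μ.insertNth (0 : ℝ) q : Fin (d + 1) → ℝ) ∈ BZ d := by rwa [removeNth_base]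
  have hq0' : μ.removeNth (μ.insertNth (0 : ℝ) q : Fin (d + 1) → ℝ) ≠ 0 := by rwa [removeNth_base]
  have e : (fun s : ℝ => chainB α β μ 3 (μ.insertNth (s : ℂ) (ofRealVec q))) = remSl3 (wInf (d := d)) (μ.insertNth (0 : ℝ) q) μ α β := by
    funext s; exact (chainB_succ_slice α β μ q s).2.2
  rw [e]; exact aestronglyMeasurable_remSl3_wInf hq' hq0' α β

/-- [our object] the `hmaj` row: `‖chainB 3 (insertNth μ t q)‖ ≤ 27·Krem d·(‖insertNth μ t q‖³)⁻¹` for `t ∈ [−π,π]` (the letters of `…SliceLocalLetters`). -/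
theorem chainB_hmaj (hq : q ∈ BZ d) (hq0 : q ≠ 0) {t : ℝ} (ht : t ∈ Icc (-π) π) :
    ‖chainB α β μ 3 (μ.insertNth (t : ℂ) (ofRealVec q))‖ ≤ 27 * Krem d * (‖(μ.insertNth t q : Fin (d + 1) → ℝ)‖ ^ 3)⁻¹ := by
  have hq' : μ.removeNth (μ.insertNth (0 : ℝ) q : Fin (d + 1) → ℝ) ∈ BZ d := by rwa [removeNth_base]
  have hq0' : μ.removeNth (μ.insertNth (0 : ℝ) q : Fin (d + 1) → ℝ) ≠ 0 := by rwa [removeNth_base]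
  rw [(chainB_succ_slice α β μ q t).2.2]
  have h := (norm_remSl_wInf_le_local ht hq' hq0' α β).2.2.2
  rw [update_insertNth] at h
  rw [← div_eq_mul_inv]; exact h

end Rows

/-! ## §4 (K1) The cubic decay of the remainder kernel -/

/-- [our object] `CKB d := (2π)^{−(d+1)} · ∫_{BZ (d+1)} 27·Krem d·(‖s‖³)⁻¹ ds` — the constant of (K1) (finite for `3 ≤ d`). -/
def CKB (d : ℕ) : ℝ := ((2 * π) ^ (d + 1))⁻¹ * ∫ s in BZ (d + 1), 27 * Krem d * (‖s‖ ^ 3)⁻¹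

/-- [our object] **(K1) THE REMAINDER KERNEL DECAYS LIKE `‖z‖_∞^{−3}`**: for lattice dimension `d + 1 ≥ 4` and `z ≠ 0`, `‖KB α β z‖ ≤ CKB d ∕ ‖z‖_∞³` — three
integrations by parts in the coordinate realising the sup norm (`PuncturedCoordDerivMajorant.norm_latticeKernel_le_div_supNorm_pow_of_majorant` on the chain `chainB`,
null set `{0}` of transverse momenta, majorant `27·Krem d·(‖s‖³)⁻¹ ∈ L¹(BZ (d+1))` by `BrillouinRadial.integrableOn_inv_norm_pow_BZ`). -/
theorem norm_KB_le_div_supNorm_cube (hd : 3 ≤ d) (α β : Fin (d + 1)) {z : Fin (d + 1) → ℤ} (hz : z ≠ 0) :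
    ‖KB α β z‖ ≤ CKB d / supNorm z ^ 3 := by
  haveI : Nonempty (Fin d) := ⟨⟨0, by omega⟩⟩
  have hN : volume ({0} : Set (Fin d → ℝ)) = 0 := measure_singleton 0
  have hg : IntegrableOn (fun s : Fin (d + 1) → ℝ => 27 * Krem d * (‖s‖ ^ 3)⁻¹) (BZ (d + 1)) volume :=
    (integrableOn_inv_norm_pow_BZ hd).const_mul (27 * Krem d)
  have h := norm_latticeKernel_le_div_supNorm_pow_of_majorant (G := symB α β) 3 (chainB α β) (fun μ => rfl) {0} hN
    (integrableOn_integrand_symB α β)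
    (fun μ j hj q hq hq0 t ht => chainB_hder hq hq0 j hj t ht)
    (fun μ j hj q hq hq0 => chainB_hcont hq hq0 j hj)
    (fun μ j hj q hq hq0 => chainB_hper hq hq0 j hj)
    (fun μ q hq hq0 => chainB_hmeas hq hq0) hg
    (fun μ q hq hq0 t ht => chainB_hmaj hq hq0 ht) z hz
  unfold KB CKB
  exact h

end Summit.QuantumFields.BalabanUV.Beta.FP.PerfectPropagatorKernel

end
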